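import Summits.MatrixMultiplication.MatrixMultiplication.Theorems.OutsiderSandwichToricCeilingPowTwoCwBaseDataC
import Summits.MatrixMultiplication.MatrixMultiplication.Theorems.OutsiderSandwichToricCeilingPowTwoCwBaseDataTwoA
import Summits.MatrixMultiplication.MatrixMultiplication.Theorems.OutsiderSandwichToricCeilingPowTwoCwBaseDataTwoC

/-!
# OutsiderSandwich — toric ceiling of `cw₂^{⊠N}`: the `N = 3` two-cw base, TWO-NESS census C
(groups `cX6`, `cX7`, `cX8`; decomp-mm lens 4, gen 47, kernel K47-8 census C; THESES-FREE, `ω`-free;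
helper toward `LaserTangency`, stmt-32268)

LABEL.  TORIC · FINITE (`N = 3`) · NEC-side instrument.  For each group `cXk`, in CHUNKS of at
most 120 instances (kernel memory ceiling on the gate): the second certificate `datbk[i]`
(`…TwoCwBaseDataTwoC`) decodes to a `valid` perfect matching of the instance `(instOf cXk)[i]`
which misses a row of the matching decoded from the first certificate `datak[i]`
(`…TwoCwBaseDataC`) — `census₂_k_r`, `decide +kernel`, standard axioms (no `native_decide`, no
`ofReduceBool`); `lenbk`, `dlenbk`, `cover₂_k` are bookkeeping.  Consumed by `…TwoCwBaseTwo`.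
WHAT THIS IS NOT: no statement about tensors or `ω`.
-/

set_option linter.dupNamespace false
set_option maxRecDepth 200000
set_option Elab.async false

namespace Summit.MatrixMultiplication.MatrixMultiplication.Theorems.OutsiderSandwichToricCeilingPowTwoCwBaseCensusTwoC

open Summit.MatrixMultiplication.MatrixMultiplication.Theorems.OutsiderSandwichToricCeilingPowTwoCwBaseDefs
open Summit.MatrixMultiplication.MatrixMultiplication.Theorems.OutsiderSandwichToricCeilingPowTwoCwBaseDataC
open Summit.MatrixMultiplication.MatrixMultiplication.Theorems.OutsiderSandwichToricCeilingPowTwoCwBaseDataTwoA (goodD₂)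
open Summit.MatrixMultiplication.MatrixMultiplication.Theorems.OutsiderSandwichToricCeilingPowTwoCwBaseDataTwoC

set_option maxHeartbeats 0 in
/-- Group `cX6`: the second-certificate list has the length of the instance list (140). -/
theorem lenb6 : (instOf cX6).length = datb6.length := by
  decide +kernel

/-- Group `cX6`: number of second certificates. -/
theorem dlenb6 : datb6.length = 140 := by
  decide +kernel

set_option maxHeartbeats 0 in
/-- TWO-NESS CENSUS, group `cX6`, instances `0 … 119` (kernel-decided): each second
certificate decodes to a valid perfect matching missing a row of the first one. -/
theorem census₂_6_0 : ((((instOf cX6).zip (data6.zip datb6)).drop 0).take 120).all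
    (fun p => goodD₂ p.1 p.2.1 p.2.2) = true := by
  decide +kernel

set_option maxHeartbeats 0 in
/-- TWO-NESS CENSUS, group `cX6`, instances `120 … 139` (kernel-decided): each second
certificate decodes to a valid perfect matching missing a row of the first one. -/
theorem census₂_6_1 : ((((instOf cX6).zip (data6.zip datb6)).drop 120).take 20).all
    (fun p => goodD₂ p.1 p.2.1 p.2.2) = true := by
  decide +kernel

/-- Group `cX6`: every index is covered by a decided chunk. -/
theorem cover₂_6 : ∀ i < datb6.length, ∃ lo n, lo ≤ i ∧ i < lo + n ∧
    ((((instOf cX6).zip (data6.zip datb6)).drop lo).take n).all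
      (fun p => goodD₂ p.1 p.2.1 p.2.2) = true := by
  intro i hi
  rw [dlenb6] at hi
  by_cases h0 : i < 120
  · exact ⟨0, 120, by omega, by omega, census₂_6_0⟩
  · exact ⟨120, 20, by omega, by omega, census₂_6_1⟩

set_option maxHeartbeats 0 in
/-- Group `cX7`: the second-certificate list has the length of the instance list (420). -/
theorem lenb7 : (instOf cX7).length = datb7.length := by
  decide +kernel

/-- Group `cX7`: number of second certificates. -/
theorem dlenb7 : datb7.length = 420 := by
  decide +kernel

set_option maxHeartbeats 0 in
/-- TWO-NESS CENSUS, group `cX7`, instances `0 … 119` (kernel-decided): each second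
certificate decodes to a valid perfect matching missing a row of the first one. -/
theorem census₂_7_0 : ((((instOf cX7).zip (data7.zip datb7)).drop 0).take 120).all
    (fun p => goodD₂ p.1 p.2.1 p.2.2) = true := by
  decide +kernel

set_option maxHeartbeats 0 in
/-- TWO-NESS CENSUS, group `cX7`, instances `120 … 239` (kernel-decided): each second
certificate decodes to a valid perfect matching missing a row of the first one. -/
theorem census₂_7_1 : ((((instOf cX7).zip (data7.zip datb7)).drop 120).take 120).all
    (fun p => goodD₂ p.1 p.2.1 p.2.2) = true := by
  decide +kernel

set_option maxHeartbeats 0 in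
/-- TWO-NESS CENSUS, group `cX7`, instances `240 … 359` (kernel-decided): each second
certificate decodes to a valid perfect matching missing a row of the first one. -/
theorem census₂_7_2 : ((((instOf cX7).zip (data7.zip datb7)).drop 240).take 120).all
    (fun p => goodD₂ p.1 p.2.1 p.2.2) = true := by
  decide +kernel

set_option maxHeartbeats 0 in
/-- TWO-NESS CENSUS, group `cX7`, instances `360 … 419` (kernel-decided): each second
certificate decodes to a valid perfect matching missing a row of the first one. -/
theorem census₂_7_3 : ((((instOf cX7).zip (data7.zip datb7)).drop 360).take 60).all
    (fun p => goodD₂ p.1 p.2.1 p.2.2) = true := by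
  decide +kernel

/-- Group `cX7`: every index is covered by a decided chunk. -/
theorem cover₂_7 : ∀ i < datb7.length, ∃ lo n, lo ≤ i ∧ i < lo + n ∧
    ((((instOf cX7).zip (data7.zip datb7)).drop lo).take n).all
      (fun p => goodD₂ p.1 p.2.1 p.2.2) = true := by
  intro i hi
  rw [dlenb7] at hi
  by_cases h0 : i < 120
  · exact ⟨0, 120, by omega, by omega, census₂_7_0⟩
  by_cases h1 : i < 240
  · exact ⟨120, 120, by omega, by omega, census₂_7_1⟩
  by_cases h2 : i < 360
  · exact ⟨240, 120, by omega, by omega, census₂_7_2⟩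
  · exact ⟨360, 60, by omega, by omega, census₂_7_3⟩

set_option maxHeartbeats 0 in
/-- Group `cX8`: the second-certificate list has the length of the instance list (280). -/
theorem lenb8 : (instOf cX8).length = datb8.length := by
  decide +kernel

/-- Group `cX8`: number of second certificates. -/
theorem dlenb8 : datb8.length = 280 := by
  decide +kernel

set_option maxHeartbeats 0 in
/-- TWO-NESS CENSUS, group `cX8`, instances `0 … 119` (kernel-decided): each second
certificate decodes to a valid perfect matching missing a row of the first one. -/
theorem census₂_8_0 : ((((instOf cX8).zip (data8.zip datb8)).drop 0).take 120).all
    (fun p => goodD₂ p.1 p.2.1 p.2.2) = true := by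
  decide +kernel

set_option maxHeartbeats 0 in
/-- TWO-NESS CENSUS, group `cX8`, instances `120 … 239` (kernel-decided): each second
certificate decodes to a valid perfect matching missing a row of the first one. -/
theorem census₂_8_1 : ((((instOf cX8).zip (data8.zip datb8)).drop 120).take 120).all
    (fun p => goodD₂ p.1 p.2.1 p.2.2) = true := by
  decide +kernel

set_option maxHeartbeats 0 in
/-- TWO-NESS CENSUS, group `cX8`, instances `240 … 279` (kernel-decided): each second
certificate decodes to a valid perfect matching missing a row of the first one. -/
theorem census₂_8_2 : ((((instOf cX8).zip (data8.zip datb8)).drop 240).take 40).all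
    (fun p => goodD₂ p.1 p.2.1 p.2.2) = true := by
  decide +kernel

/-- Group `cX8`: every index is covered by a decided chunk. -/
theorem cover₂_8 : ∀ i < datb8.length, ∃ lo n, lo ≤ i ∧ i < lo + n ∧
    ((((instOf cX8).zip (data8.zip datb8)).drop lo).take n).all
      (fun p => goodD₂ p.1 p.2.1 p.2.2) = true := by
  intro i hi
  rw [dlenb8] at hi
  by_cases h0 : i < 120
  · exact ⟨0, 120, by omega, by omega, census₂_8_0⟩
  by_cases h1 : i < 240
  · exact ⟨120, 120, by omega, by omega, census₂_8_1⟩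
  · exact ⟨240, 40, by omega, by omega, census₂_8_2⟩

end Summit.MatrixMultiplication.MatrixMultiplication.Theorems.OutsiderSandwichToricCeilingPowTwoCwBaseCensusTwoC
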